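import Literature.AlgebraicGeometry.Frobenioids.PerfectionFunctoriality
import Literature.AlgebraicGeometry.Frobenioids.EquivalenceFrobeniusQuasiIsotropicOfPreSteps
import Literature.AlgebraicGeometry.Frobenioids.EquivalencePreStepsQuasiIsotropicFSMFF2024
import HarnessLib

/-!
# Frobenioids I, Theorem 3.4 (iii), the perfection square for quasi-isotropic Frobenioids — from pre-step
# preservation, and over bases of FSMFF-type in the author's REVISED (2024) sense

Mochizuki, *The geometry of Frobenioids I: the general theory*, Kyushu J. Math. **62** (2008), Theorem
3.4 (iii), p. 62 l. 42 – p. 63 l. 2 [cite: MochizukiFrdI2008, Thm. 3.4 (iii) p.62]: "`Ψ` induces a … functor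
`Ψ^pf : C₁^pf → C₂^pf` that fits into a `1`-commutative diagram [with `C_i → C_i^pf`]"; condition (b) of
"FSMFF-type" as revised in the author's *Comments* (January 2024), item (28) [cite: MochizukiFrdIComments2024, (28) p.3].

PROOF-ONLY file (seat abc-iut-w4-d088; downstream of GAP-LEDGER row G-L1d8-1, per abc-iut-L1-lead R100 (1)): the
twin of `PerfectionSquareFSM.lean` (sub-node `FrdI:Thm3.4(iii)/L01p PfSquare` over FSM-type bases) with the
FSM-type input `FrdI.thm34iii_morphisms_of_isOfFSMType` (abc-iut-L1-t13) replaced by abc-iut-L1-t11's (ii)-agnostic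
`FrdI.OfPreSteps.thm34iii_morphisms`:
* `isFrobeniusCompatible_of_preservesPreSteps` — for Frobenioids of quasi-isotropic type with non-dilating divisor
  monoids and a non-group-like object on each side, an equivalence `Ψ` such that `Ψ` AND `Ψ⁻¹` preserve pre-steps
  (the conclusion of Thm. 3.4 (ii) — NO hypothesis on the bases) is Frobenius-compatible (Frobenius type and
  Frobenius degrees preserved, `Ψ^{ℕ≥1} = id`); `thm34iii_pfSquare_of_preservesPreSteps` — hence `Ψ^pf :
  C₁^pf ⥲ C₂^pf` (abc-iut-L1-d1's `PreFrobenioid.Perfection.map`) is an equivalence `1`-commuting with `C_i → C_i^pf`;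
* instances over bases of FSMFF-type (revised): `isFrobeniusCompatible_of_isOfFSMFFType2024`,
  `thm34iii_pfSquare_of_isOfFSMFFType2024`, `perfectionMap_isEquivalence_of_isOfFSMFFType2024`
  (pre-steps preserved there: abc-iut-L1-t11's `FrdI.isPreStep_map_of_quasiIsotropic_of_isOfFSMFFType2024`).
No new definition; no statement of the paper is restated or strengthened.
-/

namespace Literature.AlgebraicGeometry.Frobenioids

namespace FrdI

open CategoryTheory Opposite

universe w v v' u u'

variable {D₁ : Type u} [Category.{v} D₁] {Φ₁ : D₁ᵒᵖ ⥤ CommMonCat.{w}} {C₁ : Type u'} [Category.{v'} C₁]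
  {D₂ : Type u} [Category.{v} D₂] {Φ₂ : D₂ᵒᵖ ⥤ CommMonCat.{w}} {C₂ : Type u'} [Category.{v'} C₂]
  {F₁ : C₁ ⥤ ElemFrobenioid Φ₁} {F₂ : C₂ ⥤ ElemFrobenioid Φ₂}

/-! ### From pre-step preservation (no hypothesis on the bases) -/

/-- For Frobenioids of quasi-isotropic type with non-dilating divisor monoids and a non-group-like object on each
side, an equivalence `Ψ : C₁ ≌ C₂` such that `Ψ` and `Ψ⁻¹` preserve pre-steps carries arrows of Frobenius type to
arrows of Frobenius type of the same Frobenius degree, i.e. is Frobenius-compatible in the sense of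
`PerfectionFunctoriality.lean` (abc-iut-L1-t11's `FrdI.OfPreSteps.thm34iii_morphisms`: `Ψ^{ℕ≥1} = id`).
[cite: MochizukiFrdI2008, Thm. 3.4 (iii) p.62] -/
theorem isFrobeniusCompatible_of_preservesPreSteps (hF₁ : PreFrobenioid.IsFrobenioid F₁)
    (hF₂ : PreFrobenioid.IsFrobenioid F₂) (hq₁ : (PreFrobenioidData.ofFunctor Φ₁ F₁).IsOfQuasiIsotropicType)
    (hq₂ : (PreFrobenioidData.ofFunctor Φ₂ F₂).IsOfQuasiIsotropicType)
    (hnd₁ : (PreFrobenioidData.ofFunctor Φ₁ F₁).IsNonDilatingOn)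
    (hnd₂ : (PreFrobenioidData.ofFunctor Φ₂ F₂).IsNonDilatingOn) (Ψ : C₁ ≌ C₂)
    (h₁₂ : PreFrobenioidData.PreservesMor Ψ.functor (PreFrobenioidData.ofFunctor Φ₁ F₁).IsPreStep
      (PreFrobenioidData.ofFunctor Φ₂ F₂).IsPreStep)
    (h₂₁ : PreFrobenioidData.PreservesMor Ψ.inverse (PreFrobenioidData.ofFunctor Φ₂ F₂).IsPreStep
      (PreFrobenioidData.ofFunctor Φ₁ F₁).IsPreStep)
    (hN₁ : ∃ A : C₁, ¬ (PreFrobenioidData.ofFunctor Φ₁ F₁).IsGroupLikeObj A)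
    (hN₂ : ∃ A : C₂, ¬ (PreFrobenioidData.ofFunctor Φ₂ F₂).IsGroupLikeObj A) :
    PreFrobenioid.IsFrobeniusCompatible F₁ F₂ Ψ.functor := by
  obtain ⟨⟨hfr, -, -, -, -, -, -⟩, ΨN, hdeg, hΨN⟩ :=
    OfPreSteps.thm34iii_morphisms hF₁ hF₂ hq₁ hq₂ hnd₁ hnd₂ Ψ h₁₂ h₂₁ hN₁ hN₂
  subst hΨN
  refine ⟨fun A B f hf => ?_, fun A B f _ => ?_⟩
  · exact (PreFrobenioidData.ofFunctor_isFrobeniusType F₂ _).mp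
      (hfr f ((PreFrobenioidData.ofFunctor_isFrobeniusType F₁ f).mpr hf))
  · simpa only [PreFrobenioidData.ofFunctor_degFr, MulEquiv.refl_apply] using hdeg f

/-- **Theorem 3.4 (iii), perfection square, from pre-step preservation**: under the same hypotheses, for THE
perfections of `C₁`, `C₂` there is `Ψ^pf : C₁^pf → C₂^pf`, an EQUIVALENCE, with `Ψ ⋙ (C₂ → C₂^pf) ≅
(C₁ → C₁^pf) ⋙ Ψ^pf` (the first two conjuncts of `OneUniqueSquare` in abc-iut-L1-t3's typed `Thm34iii_pf`).
[cite: MochizukiFrdI2008, Thm. 3.4 (iii) p.62] -/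
theorem thm34iii_pfSquare_of_preservesPreSteps (hF₁ : PreFrobenioid.IsFrobenioid F₁)
    (hF₂ : PreFrobenioid.IsFrobenioid F₂) (hq₁ : (PreFrobenioidData.ofFunctor Φ₁ F₁).IsOfQuasiIsotropicType)
    (hq₂ : (PreFrobenioidData.ofFunctor Φ₂ F₂).IsOfQuasiIsotropicType)
    (hnd₁ : (PreFrobenioidData.ofFunctor Φ₁ F₁).IsNonDilatingOn)
    (hnd₂ : (PreFrobenioidData.ofFunctor Φ₂ F₂).IsNonDilatingOn) (Ψ : C₁ ≌ C₂)
    (h₁₂ : PreFrobenioidData.PreservesMor Ψ.functor (PreFrobenioidData.ofFunctor Φ₁ F₁).IsPreStep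
      (PreFrobenioidData.ofFunctor Φ₂ F₂).IsPreStep)
    (h₂₁ : PreFrobenioidData.PreservesMor Ψ.inverse (PreFrobenioidData.ofFunctor Φ₂ F₂).IsPreStep
      (PreFrobenioidData.ofFunctor Φ₁ F₁).IsPreStep)
    (hN₁ : ∃ A : C₁, ¬ (PreFrobenioidData.ofFunctor Φ₁ F₁).IsGroupLikeObj A)
    (hN₂ : ∃ A : C₂, ¬ (PreFrobenioidData.ofFunctor Φ₂ F₂).IsGroupLikeObj A) :
    ∃ Ψpf : (PreFrobenioidData.perfection hF₁).Pf ⥤ (PreFrobenioidData.perfection hF₂).Pf,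
      Ψpf.IsEquivalence ∧ OneCommutes Ψ.functor (PreFrobenioidData.perfection hF₂).toPf
        (PreFrobenioidData.perfection hF₁).toPf Ψpf := by
  have hΨ := isFrobeniusCompatible_of_preservesPreSteps hF₁ hF₂ hq₁ hq₂ hnd₁ hnd₂ Ψ h₁₂ h₂₁ hN₁ hN₂
  exact ⟨PreFrobenioid.Perfection.map (hF₁ := hF₁) (hF₂ := hF₂) hΨ,
    PreFrobenioid.Perfection.map_isEquivalence (hF₁ := hF₁) (hF₂ := hF₂) Ψ hΨ,
    ⟨(PreFrobenioid.Perfection.toPfCompMapIso (hF₁ := hF₁) (hF₂ := hF₂) hΨ).symm⟩⟩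

/-! ### Instances over bases of FSMFF-type in the revised (2024) sense -/

/-- Over bases of FSMFF-type (revised), quasi-isotropic type, non-dilating divisor monoids, a non-group-like object
on each side: `Ψ` is Frobenius-compatible (pre-steps preserved there by abc-iut-L1-t11's
`FrdI.isPreStep_map_of_quasiIsotropic_of_isOfFSMFFType2024`). Twin of `isFrobeniusCompatible_of_isOfFSMType`.
[cite: MochizukiFrdI2008, Thm. 3.4 (iii) p.62] [cite: MochizukiFrdIComments2024, (28) p.3] -/
theorem isFrobeniusCompatible_of_isOfFSMFFType2024 (hF₁ : PreFrobenioid.IsFrobenioid F₁)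
    (hF₂ : PreFrobenioid.IsFrobenioid F₂) (hq₁ : (PreFrobenioidData.ofFunctor Φ₁ F₁).IsOfQuasiIsotropicType)
    (hq₂ : (PreFrobenioidData.ofFunctor Φ₂ F₂).IsOfQuasiIsotropicType) (hD₁ : IsOfFSMFFType2024 D₁)
    (hD₂ : IsOfFSMFFType2024 D₂) (hnd₁ : (PreFrobenioidData.ofFunctor Φ₁ F₁).IsNonDilatingOn)
    (hnd₂ : (PreFrobenioidData.ofFunctor Φ₂ F₂).IsNonDilatingOn) (Ψ : C₁ ≌ C₂)
    (hN₁ : ∃ A : C₁, ¬ (PreFrobenioidData.ofFunctor Φ₁ F₁).IsGroupLikeObj A)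
    (hN₂ : ∃ A : C₂, ¬ (PreFrobenioidData.ofFunctor Φ₂ F₂).IsGroupLikeObj A) :
    PreFrobenioid.IsFrobeniusCompatible F₁ F₂ Ψ.functor :=
  isFrobeniusCompatible_of_preservesPreSteps hF₁ hF₂ hq₁ hq₂ hnd₁ hnd₂ Ψ
    (fun _ _ _ hφ => isPreStep_map_of_quasiIsotropic_of_isOfFSMFFType2024 hF₁ hF₂ hq₁ hq₂ hD₁ hD₂ Ψ hφ)
    (fun _ _ _ hφ => isPreStep_map_of_quasiIsotropic_of_isOfFSMFFType2024 hF₂ hF₁ hq₂ hq₁ hD₂ hD₁ Ψ.symm hφ)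
    hN₁ hN₂

/-- **Theorem 3.4 (iii), perfection square, over FSMFF-type (revised) bases** (twin of
`thm34iii_pfSquare_of_isOfFSMType`): `Ψ^pf : C₁^pf ⥲ C₂^pf` exists, is an equivalence and `1`-commutes with
`C_i → C_i^pf`. [cite: MochizukiFrdI2008, Thm. 3.4 (iii) p.62] [cite: MochizukiFrdIComments2024, (28) p.3] -/
theorem thm34iii_pfSquare_of_isOfFSMFFType2024 (hF₁ : PreFrobenioid.IsFrobenioid F₁)
    (hF₂ : PreFrobenioid.IsFrobenioid F₂) (hq₁ : (PreFrobenioidData.ofFunctor Φ₁ F₁).IsOfQuasiIsotropicType)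
    (hq₂ : (PreFrobenioidData.ofFunctor Φ₂ F₂).IsOfQuasiIsotropicType) (hD₁ : IsOfFSMFFType2024 D₁)
    (hD₂ : IsOfFSMFFType2024 D₂) (hnd₁ : (PreFrobenioidData.ofFunctor Φ₁ F₁).IsNonDilatingOn)
    (hnd₂ : (PreFrobenioidData.ofFunctor Φ₂ F₂).IsNonDilatingOn) (Ψ : C₁ ≌ C₂)
    (hN₁ : ∃ A : C₁, ¬ (PreFrobenioidData.ofFunctor Φ₁ F₁).IsGroupLikeObj A)
    (hN₂ : ∃ A : C₂, ¬ (PreFrobenioidData.ofFunctor Φ₂ F₂).IsGroupLikeObj A) :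
    ∃ Ψpf : (PreFrobenioidData.perfection hF₁).Pf ⥤ (PreFrobenioidData.perfection hF₂).Pf,
      Ψpf.IsEquivalence ∧ OneCommutes Ψ.functor (PreFrobenioidData.perfection hF₂).toPf
        (PreFrobenioidData.perfection hF₁).toPf Ψpf :=
  thm34iii_pfSquare_of_preservesPreSteps hF₁ hF₂ hq₁ hq₂ hnd₁ hnd₂ Ψ
    (fun _ _ _ hφ => isPreStep_map_of_quasiIsotropic_of_isOfFSMFFType2024 hF₁ hF₂ hq₁ hq₂ hD₁ hD₂ Ψ hφ)
    (fun _ _ _ hφ => isPreStep_map_of_quasiIsotropic_of_isOfFSMFFType2024 hF₂ hF₁ hq₂ hq₁ hD₂ hD₁ Ψ.symm hφ)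
    hN₁ hN₂

/-- The square for THE perfections with the chosen `Ψ^pf = Perfection.map`, over FSMFF-type (revised) bases:
`Ψ^pf` is an equivalence. [cite: MochizukiFrdI2008, Thm. 3.4 (iii) p.62] [cite: MochizukiFrdIComments2024, (28) p.3] -/
theorem perfectionMap_isEquivalence_of_isOfFSMFFType2024 (hF₁ : PreFrobenioid.IsFrobenioid F₁)
    (hF₂ : PreFrobenioid.IsFrobenioid F₂) (hq₁ : (PreFrobenioidData.ofFunctor Φ₁ F₁).IsOfQuasiIsotropicType)
    (hq₂ : (PreFrobenioidData.ofFunctor Φ₂ F₂).IsOfQuasiIsotropicType) (hD₁ : IsOfFSMFFType2024 D₁)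
    (hD₂ : IsOfFSMFFType2024 D₂) (hnd₁ : (PreFrobenioidData.ofFunctor Φ₁ F₁).IsNonDilatingOn)
    (hnd₂ : (PreFrobenioidData.ofFunctor Φ₂ F₂).IsNonDilatingOn) (Ψ : C₁ ≌ C₂)
    (hN₁ : ∃ A : C₁, ¬ (PreFrobenioidData.ofFunctor Φ₁ F₁).IsGroupLikeObj A)
    (hN₂ : ∃ A : C₂, ¬ (PreFrobenioidData.ofFunctor Φ₂ F₂).IsGroupLikeObj A) :
    (PreFrobenioid.Perfection.map (hF₁ := hF₁) (hF₂ := hF₂)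
        (isFrobeniusCompatible_of_isOfFSMFFType2024 hF₁ hF₂ hq₁ hq₂ hD₁ hD₂ hnd₁ hnd₂ Ψ hN₁ hN₂)).IsEquivalence :=
  PreFrobenioid.Perfection.map_isEquivalence Ψ _

end FrdI

end Literature.AlgebraicGeometry.Frobenioids
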